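import Summits.AtomisticToContinuum.Crystallization.Theorems.FrustrationRangeCertificatesPatternPricedCertificatesStubLevelLift
import Summits.AtomisticToContinuum.Crystallization.Theorems.FrustrationRangeCertificatesPatternPricedCertificatesStubBanachLimit
import Summits.AtomisticToContinuum.Crystallization.Theorems.FrustrationRangeCertificatesPatternPricedCertificatesStubPatternFarField
import Summits.AtomisticToContinuum.Crystallization.Theorems.ChargedEnergyGap.Negative.BlocksBound
import Literature.Probability.PointProcesses.LensConsistentLaw

/-!
# Crux `PatternPricedCertificates` (stmt-AtomisticToContinuum-12974), line `registered`: the priced core from the qualitative core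

**Compactness for means.** The priced Palm rigidity of point-stationary mean families (`∃ P ∀ δ R ε θ ∃ κ c Q …
c + κ·ℓ(bad) ≤ ℓ(½h_ρ)`) follows from the QUALITATIVE core (minimal-energy point-stationary mean families are `P`-patterned at
every scale) and the landed unpriced bound (`e⋆ ≤ ℓ ρ (½h_ρ)`, `stub_unpricedMeanBound`): if no price `κ_n = 1/(n+2)` works with a
near-optimal `Q_n` and `c_n = e(Q_n) − κ_n θ`, the violating families have defect mass `> θ/2` and energies `≤ e⋆ + O(κ_n)` at every
radius (projectivity, far field, `V ≤ 0` beyond `1`); their Banach limit is a minimal-energy point-stationary family with defect mass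
`≥ θ/2`, contradicting the qualitative core. (The lead c1's skeleton composition, landed here as an importable theorem.) `[folklore]`
-/

noncomputable section

open scoped BigOperators Classical

namespace Summit.AtomisticToContinuum.Crystallization.Theorems.PatternPricedCertificates

open Literature.Probability.PointProcesses (IsRootedPattern ballPattern lens reroot)
open Literature.MathematicalPhysics.StatisticalMechanics (lennardJones PeriodicConfiguration)

/-- A Banach-type limit vanishes on the null sequence `1/(n+2)`. [folklore] -/
theorem bridge_banachLimit_inv_add_two {Λ : (ℕ → ℝ) → ℝ}
    (hadd : ∀ a b : ℕ → ℝ, Λ (a + b) = Λ a + Λ b) (hsmul : ∀ (t : ℝ) (a : ℕ → ℝ), Λ (t • a) = t * Λ a)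
    (hpos : ∀ a : ℕ → ℝ, (∀ n, 0 ≤ a n ∧ a n ≤ 1) → 0 ≤ Λ a) (hone : Λ (fun _ => 1) = 1)
    (hzero : ∀ a : ℕ → ℝ, (∃ n₀ : ℕ, ∀ n, n₀ ≤ n → a n = 0) → Λ a = 0) :
    Λ (fun n : ℕ => 1 / ((n : ℝ) + 2)) = 0 := by
  have hpos' : ∀ a : ℕ → ℝ, (∀ n, True → 0 ≤ a n ∧ a n ≤ 1) → 0 ≤ Λ a :=
    fun a ha => hpos a fun n => ha n trivial
  have hκ01 : ∀ n : ℕ, 0 ≤ 1 / ((n : ℝ) + 2) ∧ 1 / ((n : ℝ) + 2) ≤ 1 := fun n => by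
    have hn : (0 : ℝ) ≤ n := Nat.cast_nonneg n
    constructor
    · positivity
    · rw [div_le_one (by linarith)]; linarith
  have h0 : 0 ≤ Λ (fun n : ℕ => 1 / ((n : ℝ) + 2)) := hpos _ hκ01
  refine le_antisymm ?_ h0
  by_contra hc
  push Not at hc
  set L := Λ (fun n : ℕ => 1 / ((n : ℝ) + 2)) with hL
  -- split at `N` with `1/(N+2) ≤ L/2`
  obtain ⟨N, hN⟩ := exists_nat_one_div_lt (half_pos hc)
  set tail : ℕ → ℝ := fun n => if N ≤ n then 1 / ((n : ℝ) + 2) else 0 with htail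
  set head : ℕ → ℝ := fun n => if N ≤ n then 0 else 1 / ((n : ℝ) + 2) with hhead
  have hsplit : (fun n : ℕ => 1 / ((n : ℝ) + 2)) = head + tail := by
    funext n; simp only [hhead, htail, Pi.add_apply]; split_ifs <;> simp
  have hhead0 : Λ head = 0 := hzero head ⟨N, fun n hn => by simp [hhead, hn]⟩
  have htail_le : Λ tail ≤ L / 2 := by
    have h := levelLift_mean_mem_Icc (Ω := fun _ => True) hadd hsmul hpos' hone (f := tail)
      (lo := 0) (hi := L / 2) (half_pos hc) (fun n _ => ?_)
    · exact h.2
    simp only [htail]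
    split_ifs with hn
    · refine ⟨by positivity, ?_⟩
      have h1 : 1 / ((n : ℝ) + 2) ≤ 1 / ((N : ℝ) + 1) := by
        apply one_div_le_one_div_of_le (by positivity)
        have : (N : ℝ) ≤ n := by exact_mod_cast hn
        linarith
      linarith
    · exact ⟨le_rfl, (half_pos hc).le⟩
  have : L = Λ head + Λ tail := by rw [hL, hsplit, hadd]
  linarith

/-- A subset of an admissible pattern is admissible. [folklore] -/
theorem bridge_isRootedPattern_filter {δ L : ℝ} {S : Finset (EuclideanSpace ℝ (Fin 3))}
    (hS : IsRootedPattern δ L S) (p : EuclideanSpace ℝ (Fin 3) → Prop) [DecidablePred p] :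
    IsRootedPattern δ L (S.filter p) :=
  ⟨fun v hv => hS.1 v (Finset.mem_filter.1 hv).1,
    fun v hv w hw hvw => hS.2 v (Finset.mem_filter.1 hv).1 w (Finset.mem_filter.1 hw).1 hvw⟩

/-- **The priced core from the qualitative core and the unpriced bound** (compactness = Banach limit
of the violating families at prices `κ_n = 1/(n+2) → 0`). [folklore] -/
theorem bridge_stationaryMeansRigidity_of :
    (∃ P : PeriodicConfiguration 3, ∀ δ : ℝ, 0 < δ → ∀ ℓ : ℝ → (Finset (EuclideanSpace ℝ (Fin 3)) → ℝ) → ℝ,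
      (∀ (ρ : ℝ) (f₁ f₂ : Finset (EuclideanSpace ℝ (Fin 3)) → ℝ), ℓ ρ (f₁ + f₂) = ℓ ρ f₁ + ℓ ρ f₂) →
      (∀ (ρ t : ℝ) (f : Finset (EuclideanSpace ℝ (Fin 3)) → ℝ), ℓ ρ (t • f) = t * ℓ ρ f) →
      (∀ (ρ : ℝ) (f : Finset (EuclideanSpace ℝ (Fin 3)) → ℝ), (∀ S : Finset (EuclideanSpace ℝ (Fin 3)), IsRootedPattern δ ρ S → 0 ≤ f S ∧ f S ≤ 1) → 0 ≤ ℓ ρ f) →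
      (∀ ρ : ℝ, ℓ ρ (fun _ => 1) = 1) →
      (∀ ρ ρ' : ℝ, ρ ≤ ρ' → ∀ f : Finset (EuclideanSpace ℝ (Fin 3)) → ℝ, ℓ ρ' (fun S => f (ballPattern ρ S)) = ℓ ρ f) →
      (∀ r ρ : ℝ, 0 ≤ r → ∀ g : EuclideanSpace ℝ (Fin 3) → Finset (EuclideanSpace ℝ (Fin 3)) → Finset (EuclideanSpace ℝ (Fin 3)) → ℝ, (∃ M : ℝ, ∀ v p q, |g v p q| ≤ M) →
        ℓ ρ (fun S => ∑ v ∈ lens r ρ S, (g v (ballPattern r S) (ballPattern r (reroot S v)) - g (-v) (ballPattern r (reroot S v)) (ballPattern r S))) = 0) →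
      (∀ η : ℝ, 0 < η → ∃ ρ : ℝ, 1 ≤ ρ ∧ ℓ ρ (fun S => (∑ v ∈ S, lennardJones ‖v‖) / 2) ≤ (⨅ Q : PeriodicConfiguration 3, Q.energyPerParticle lennardJones) + η) →
      ∀ R ε : ℝ, 0 < R → 0 < ε →
        ℓ (R + ε) (fun S => (if (∃ A : EuclideanSpace ℝ (Fin 3) →ₗᵢ[ℝ] EuclideanSpace ℝ (Fin 3), (∀ p ∈ P.points, ‖p‖ ≤ R → ∃ v ∈ insert (0 : EuclideanSpace ℝ (Fin 3)) S, dist v (A p) ≤ ε) ∧ (∀ v ∈ insert (0 : EuclideanSpace ℝ (Fin 3)) S, ‖v‖ ≤ R → ∃ p ∈ P.points, dist v (A p) ≤ ε)) then (0 : ℝ) else 1)) = 0) →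
    (∀ δ : ℝ, 0 < δ → ∀ ℓ : ℝ → (Finset (EuclideanSpace ℝ (Fin 3)) → ℝ) → ℝ,
      (∀ (ρ : ℝ) (f₁ f₂ : Finset (EuclideanSpace ℝ (Fin 3)) → ℝ), ℓ ρ (f₁ + f₂) = ℓ ρ f₁ + ℓ ρ f₂) →
      (∀ (ρ t : ℝ) (f : Finset (EuclideanSpace ℝ (Fin 3)) → ℝ), ℓ ρ (t • f) = t * ℓ ρ f) →
      (∀ (ρ : ℝ) (f : Finset (EuclideanSpace ℝ (Fin 3)) → ℝ), (∀ S : Finset (EuclideanSpace ℝ (Fin 3)), IsRootedPattern δ ρ S → 0 ≤ f S ∧ f S ≤ 1) → 0 ≤ ℓ ρ f) →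
      (∀ ρ : ℝ, ℓ ρ (fun _ => 1) = 1) →
      (∀ ρ ρ' : ℝ, ρ ≤ ρ' → ∀ f : Finset (EuclideanSpace ℝ (Fin 3)) → ℝ, ℓ ρ' (fun S => f (ballPattern ρ S)) = ℓ ρ f) →
      (∀ r ρ : ℝ, 0 ≤ r → ∀ g : EuclideanSpace ℝ (Fin 3) → Finset (EuclideanSpace ℝ (Fin 3)) → Finset (EuclideanSpace ℝ (Fin 3)) → ℝ, (∃ M : ℝ, ∀ v p q, |g v p q| ≤ M) →
        ℓ ρ (fun S => ∑ v ∈ lens r ρ S, (g v (ballPattern r S) (ballPattern r (reroot S v)) - g (-v) (ballPattern r (reroot S v)) (ballPattern r S))) = 0) →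
      ∀ ρ : ℝ, 1 ≤ ρ → (⨅ Q : PeriodicConfiguration 3, Q.energyPerParticle lennardJones) ≤
        ℓ ρ (fun S => (∑ v ∈ S, lennardJones ‖v‖) / 2)) →
    ∃ P : PeriodicConfiguration 3, ∀ δ R ε θ : ℝ, 0 < δ → 0 < R → 0 < ε → 0 < θ →
      ∃ (κ c : ℝ) (Q : PeriodicConfiguration 3), 0 < κ ∧ κ ≤ 1 ∧
        Q.energyPerParticle lennardJones ≤ c + κ * θ ∧
        ∀ ℓ : ℝ → (Finset (EuclideanSpace ℝ (Fin 3)) → ℝ) → ℝ,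
          (∀ (ρ : ℝ) (f₁ f₂ : Finset (EuclideanSpace ℝ (Fin 3)) → ℝ), ℓ ρ (f₁ + f₂) = ℓ ρ f₁ + ℓ ρ f₂) →
          (∀ (ρ t : ℝ) (f : Finset (EuclideanSpace ℝ (Fin 3)) → ℝ), ℓ ρ (t • f) = t * ℓ ρ f) →
          (∀ (ρ : ℝ) (f : Finset (EuclideanSpace ℝ (Fin 3)) → ℝ), (∀ S : Finset (EuclideanSpace ℝ (Fin 3)), IsRootedPattern δ ρ S → 0 ≤ f S ∧ f S ≤ 1) → 0 ≤ ℓ ρ f) →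
          (∀ ρ : ℝ, ℓ ρ (fun _ => 1) = 1) →
          (∀ ρ ρ' : ℝ, ρ ≤ ρ' → ∀ f : Finset (EuclideanSpace ℝ (Fin 3)) → ℝ, ℓ ρ' (fun S => f (ballPattern ρ S)) = ℓ ρ f) →
          (∀ r ρ : ℝ, 0 ≤ r → ∀ g : EuclideanSpace ℝ (Fin 3) → Finset (EuclideanSpace ℝ (Fin 3)) → Finset (EuclideanSpace ℝ (Fin 3)) → ℝ, (∃ M : ℝ, ∀ v p q, |g v p q| ≤ M) →
            ℓ ρ (fun S => ∑ v ∈ lens r ρ S, (g v (ballPattern r S) (ballPattern r (reroot S v)) - g (-v) (ballPattern r (reroot S v)) (ballPattern r S))) = 0) →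
          ∀ ρ : ℝ, R + ε ≤ ρ → 1 ≤ ρ →
            c + κ * ℓ ρ (fun S => (if (∃ A : EuclideanSpace ℝ (Fin 3) →ₗᵢ[ℝ] EuclideanSpace ℝ (Fin 3), (∀ p ∈ P.points, ‖p‖ ≤ R → ∃ v ∈ insert (0 : EuclideanSpace ℝ (Fin 3)) S, dist v (A p) ≤ ε) ∧ (∀ v ∈ insert (0 : EuclideanSpace ℝ (Fin 3)) S, ‖v‖ ≤ R → ∃ p ∈ P.points, dist v (A p) ≤ ε)) then (0 : ℝ) else 1)) ≤
              ℓ ρ (fun S => (∑ v ∈ S, lennardJones ‖v‖) / 2) := by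
  intro hQ hU
  obtain ⟨P, hP⟩ := hQ
  refine ⟨P, fun δ R ε θ hδ hR hε hθ => ?_⟩
  by_contra hcon
  push Not at hcon
  -- near-optimal periodic `Q_n`, prices `κ_n = 1/(n+2)`, constants `c_n = e(Q_n) − κ_n θ`
  set estar : ℝ := (⨅ Q : PeriodicConfiguration 3, Q.energyPerParticle lennardJones) with hestar
  have hB := Summit.AtomisticToContinuum.Crystallization.Theorems.ChargedEnergyGapNegative.bddBelow_energyPerParticle_lennardJones
  set κ : ℕ → ℝ := fun n => 1 / ((n : ℝ) + 2) with hκdef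
  have hκ0 : ∀ n, 0 < κ n := fun n => by simp only [hκdef]; positivity
  have hκ1 : ∀ n, κ n ≤ 1 := fun n => by
    simp only [hκdef]
    rw [div_le_one (by positivity)]
    linarith [(Nat.cast_nonneg n : (0 : ℝ) ≤ n)]
  have hQn : ∀ n : ℕ, ∃ Q : PeriodicConfiguration 3,
      Q.energyPerParticle lennardJones < estar + κ n * θ / 2 := fun n =>
    exists_lt_of_ciInf_lt (by have := hκ0 n; simp only [hestar]; nlinarith)
  choose Qn hQn using hQn
  choose ℓ h1 h2 h3 h4 h5 h6 ρn hρn1 hρn2 hviol using fun n : ℕ =>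
    hcon (κ n) ((Qn n).energyPerParticle lennardJones - κ n * θ) (Qn n) (hκ0 n) (hκ1 n) (by linarith)
  -- defect masses `b_n` and their lower bound `θ/2`
  set badf : Finset (EuclideanSpace ℝ (Fin 3)) → ℝ := fun S => (if (∃ A : EuclideanSpace ℝ (Fin 3) →ₗᵢ[ℝ] EuclideanSpace ℝ (Fin 3), (∀ p ∈ P.points, ‖p‖ ≤ R → ∃ v ∈ insert (0 : EuclideanSpace ℝ (Fin 3)) S, dist v (A p) ≤ ε) ∧ (∀ v ∈ insert (0 : EuclideanSpace ℝ (Fin 3)) S, ‖v‖ ≤ R → ∃ p ∈ P.points, dist v (A p) ≤ ε)) then (0 : ℝ) else 1) with hbadf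
  set halff : Finset (EuclideanSpace ℝ (Fin 3)) → ℝ := fun S => (∑ v ∈ S, Literature.MathematicalPhysics.StatisticalMechanics.lennardJones ‖v‖) / 2 with hhalff
  have hbad_cyl : (fun S => badf (ballPattern (R + ε) S)) = badf := by
    funext S
    simp only [hbadf]
    rw [levelLift_good_ballPattern_iff P hε.le le_rfl S]
  set b : ℕ → ℝ := fun n => ℓ n (R + ε) badf with hb
  have hbρ : ∀ n, ℓ n (ρn n) badf = b n := fun n => by
    have h := h5 n (R + ε) (ρn n) (hρn1 n) badf
    rw [hbad_cyl] at h
    exact h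
  have hb01 : ∀ n, 0 ≤ b n ∧ b n ≤ 1 := fun n =>
    levelLift_mean_mem_Icc (Ω := fun S => IsRootedPattern δ (R + ε) S) (h1 n (R + ε)) (h2 n (R + ε))
      (h3 n (R + ε)) (h4 n (R + ε)) zero_lt_one (fun S _ => by
        simp only [hbadf]; split_ifs <;> norm_num)
  have hbθ : ∀ n, θ / 2 < b n := fun n => by
    have hUn := hU δ hδ (ℓ n) (h1 n) (h2 n) (h3 n) (h4 n) (h5 n) (h6 n) (ρn n) (hρn2 n)
    have hv := hviol n
    rw [hbρ n] at hv
    have hq := hQn n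
    -- κ_n b_n > e⋆ − c_n ≥ κ_n θ / 2
    have hkb : κ n * (θ / 2) < κ n * b n := by
      simp only [hestar] at hq hUn
      nlinarith
    exact lt_of_mul_lt_mul_left hkb (hκ0 n).le
  -- energies at every radius `ρ ≥ 1`: `ℓ_n ρ (½h) ≤ e⋆ + κ_n (1 + θ/2) + η/2` once `ρ ≥ ρfar(η)`
  have henergy : ∀ η : ℝ, 0 < η → ∃ ρ : ℝ, 1 ≤ ρ ∧ ∀ n,
      ℓ n ρ halff ≤ estar + κ n * (1 + θ / 2) + η / 2 := by
    intro η hη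
    obtain ⟨ρfar, hfar⟩ := Summit.AtomisticToContinuum.Crystallization.Theorems.PatternPricedCertificates.stub_patternFarField δ hδ η hη
    refine ⟨max 1 ρfar, le_max_left _ _, fun n => ?_⟩
    set ρ := max 1 ρfar with hρdef
    have hρ1 : 1 ≤ ρ := le_max_left _ _
    have hρfar : ρfar ≤ ρ := le_max_right _ _
    -- the violation at radius ρ_n, and c_n + κ_n b_n ≤ e⋆ + κ_n (1 + θ/2)
    have hv := hviol n
    rw [hbρ n] at hv
    have hq := hQn n
    have hcn : (Qn n).energyPerParticle lennardJones - κ n * θ + κ n * b n ≤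
        estar + κ n * (1 + θ / 2) := by
      have := (hb01 n).2
      have hk := hκ0 n
      nlinarith
    rcases le_or_gt ρ (ρn n) with hle | hgt
    · -- ρ ≤ ρ_n: ℓ_n ρ (½h) = ℓ_n ρ_n (½h ∘ B_ρ) ≤ ℓ_n ρ_n (½h) + η/2
      have hproj := h5 n ρ (ρn n) hle halff
      have hmono : ℓ n (ρn n) (fun S => halff (ballPattern ρ S)) ≤
          ℓ n (ρn n) (fun S => halff S + η / 2) := by
        refine levelLift_mean_mono (Ω := fun S => IsRootedPattern δ (ρn n) S) (h1 n _) (h2 n _)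
          (h3 n _) (M := η) hη (fun S hS => ?_) (fun S hS => ?_)
        · have hf := hfar ρ (ρn n) hρfar S hS
          have hsplit := Finset.sum_filter_add_sum_filter_not S (fun v => ‖v‖ ≤ ρ)
            (fun v => lennardJones ‖v‖)
          have hball : ∑ v ∈ ballPattern ρ S, lennardJones ‖v‖ =
              ∑ v ∈ S.filter (fun v => ‖v‖ ≤ ρ), lennardJones ‖v‖ := rfl
          simp only [hhalff]
          rw [hball]
          linarith
        · have hsplit := Finset.sum_filter_add_sum_filter_not S (fun v => ‖v‖ ≤ ρ)
            (fun v => lennardJones ‖v‖)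
          have hball : ∑ v ∈ ballPattern ρ S, lennardJones ‖v‖ =
              ∑ v ∈ S.filter (fun v => ‖v‖ ≤ ρ), lennardJones ‖v‖ := rfl
          have hfar0 : ∑ v ∈ S.filter (fun v => ¬ ‖v‖ ≤ ρ), lennardJones ‖v‖ ≤ 0 := by
            refine Finset.sum_nonpos fun v hv => ?_
            simp only [Finset.mem_filter, not_le] at hv
            exact Literature.MathematicalPhysics.StatisticalMechanics.lennardJones_nonpos (by linarith [hv.2])
          simp only [hhalff]
          rw [hball]
          linarith
      have hconst : ℓ n (ρn n) (fun S => halff S + η / 2) = ℓ n (ρn n) halff + η / 2 := by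
        have h : (fun S : Finset (EuclideanSpace ℝ (Fin 3)) => halff S + η / 2) =
            halff + (fun _ => η / 2) := by
          funext S; simp only [Pi.add_apply]
        rw [h, h1 n, levelLift_mean_const (h2 n _) (h4 n _)]
      rw [← hproj]
      linarith
    · -- ρ_n < ρ: ℓ_n ρ (½h) ≤ ℓ_n ρ (½h ∘ B_{ρ_n}) = ℓ_n ρ_n (½h)
      have hproj := h5 n (ρn n) ρ hgt.le halff
      obtain ⟨Mρ, hMρ⟩ := levelLift_abs_sum_le hδ ρ
      have hmono : ℓ n ρ halff ≤ ℓ n ρ (fun S => halff (ballPattern (ρn n) S)) := by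
        refine levelLift_mean_mono (Ω := fun S => IsRootedPattern δ ρ S) (h1 n _) (h2 n _)
          (h3 n _) (M := Mρ + 1) (by linarith [(abs_nonneg _).trans (hMρ ∅ (Literature.Probability.PointProcesses.isRootedPattern_empty δ ρ))])
          (fun S hS => ?_) (fun S hS => ?_)
        · have hsplit := Finset.sum_filter_add_sum_filter_not S (fun v => ‖v‖ ≤ ρn n)
            (fun v => lennardJones ‖v‖)
          have hball : ∑ v ∈ ballPattern (ρn n) S, lennardJones ‖v‖ =
              ∑ v ∈ S.filter (fun v => ‖v‖ ≤ ρn n), lennardJones ‖v‖ := rfl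
          have hfar0 : ∑ v ∈ S.filter (fun v => ¬ ‖v‖ ≤ ρn n), lennardJones ‖v‖ ≤ 0 := by
            refine Finset.sum_nonpos fun v hv => ?_
            simp only [Finset.mem_filter, not_le] at hv
            exact Literature.MathematicalPhysics.StatisticalMechanics.lennardJones_nonpos (by linarith [hv.2, hρn2 n])
          simp only [hhalff]
          rw [hball]
          linarith
        · have hA := hMρ S hS
          have hB' := hMρ _ (bridge_isRootedPattern_filter hS (fun v => ‖v‖ ≤ ρn n))
          have hball : ∑ v ∈ ballPattern (ρn n) S, lennardJones ‖v‖ =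
              ∑ v ∈ S.filter (fun v => ‖v‖ ≤ ρn n), lennardJones ‖v‖ := rfl
          simp only [hhalff]
          rw [hball]
          rw [abs_le] at hA hB'
          linarith [hA.1, hB'.2]
      rw [hproj] at hmono
      linarith
  -- the Banach limit of the violating families
  obtain ⟨Λ, hΛadd, hΛsmul, hΛpos, hΛone, hΛzero⟩ := Summit.AtomisticToContinuum.Crystallization.Theorems.PatternPricedCertificates.stub_banachLimit
  have hΛpos' : ∀ a : ℕ → ℝ, (∀ n, True → 0 ≤ a n ∧ a n ≤ 1) → 0 ≤ Λ a :=
    fun a ha => hΛpos a fun n => ha n trivial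
  set ℓ₀ : ℝ → (Finset (EuclideanSpace ℝ (Fin 3)) → ℝ) → ℝ := fun ρ f => Λ (fun n => ℓ n ρ f) with hℓ₀
  have G1 : ∀ (ρ : ℝ) (f₁ f₂ : Finset (EuclideanSpace ℝ (Fin 3)) → ℝ),
      ℓ₀ ρ (f₁ + f₂) = ℓ₀ ρ f₁ + ℓ₀ ρ f₂ := by
    intro ρ f₁ f₂
    simp only [hℓ₀]
    rw [← hΛadd]
    congr 1
    funext n
    exact h1 n ρ f₁ f₂
  have G2 : ∀ (ρ t : ℝ) (f : Finset (EuclideanSpace ℝ (Fin 3)) → ℝ), ℓ₀ ρ (t • f) = t * ℓ₀ ρ f := by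
    intro ρ t f
    simp only [hℓ₀]
    rw [← hΛsmul]
    congr 1
    funext n
    exact h2 n ρ t f
  have G3 : ∀ (ρ : ℝ) (f : Finset (EuclideanSpace ℝ (Fin 3)) → ℝ),
      (∀ S : Finset (EuclideanSpace ℝ (Fin 3)), IsRootedPattern δ ρ S → 0 ≤ f S ∧ f S ≤ 1) →
      0 ≤ ℓ₀ ρ f := by
    intro ρ f hf
    simp only [hℓ₀]
    refine hΛpos _ fun n => ?_
    exact levelLift_mean_mem_Icc (Ω := fun S => IsRootedPattern δ ρ S)
      (h1 n ρ) (h2 n ρ) (h3 n ρ) (h4 n ρ) zero_lt_one hf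
  have G4 : ∀ ρ : ℝ, ℓ₀ ρ (fun _ => 1) = 1 := by
    intro ρ
    simp only [hℓ₀]
    have h : (fun n => ℓ n ρ (fun _ => (1 : ℝ))) = fun _ => 1 := funext fun n => h4 n ρ
    rw [h, hΛone]
  have G5 : ∀ ρ ρ' : ℝ, ρ ≤ ρ' → ∀ f : Finset (EuclideanSpace ℝ (Fin 3)) → ℝ,
      ℓ₀ ρ' (fun S => f (ballPattern ρ S)) = ℓ₀ ρ f := by
    intro ρ ρ' hρρ' f
    simp only [hℓ₀]
    congr 1
    funext n
    exact h5 n ρ ρ' hρρ' f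
  have G6 : ∀ r ρ : ℝ, 0 ≤ r →
      ∀ g : EuclideanSpace ℝ (Fin 3) → Finset (EuclideanSpace ℝ (Fin 3)) → Finset (EuclideanSpace ℝ (Fin 3)) → ℝ, (∃ M : ℝ, ∀ v p q, |g v p q| ≤ M) →
        ℓ₀ ρ (fun S => ∑ v ∈ Literature.Probability.PointProcesses.lens r ρ S, (g v (Literature.Probability.PointProcesses.ballPattern r S) (Literature.Probability.PointProcesses.ballPattern r (Literature.Probability.PointProcesses.reroot S v)) - g (-v) (Literature.Probability.PointProcesses.ballPattern r (Literature.Probability.PointProcesses.reroot S v)) (Literature.Probability.PointProcesses.ballPattern r S))) = 0 := by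
    intro r ρ hr g hg
    simp only [hℓ₀]
    refine hΛzero _ ⟨0, fun n _ => ?_⟩
    exact h6 n r ρ hr g hg
  -- `ℓ₀` has minimal energy
  have hmin : ∀ η : ℝ, 0 < η → ∃ ρ : ℝ, 1 ≤ ρ ∧ ℓ₀ ρ halff ≤ estar + η := by
    intro η hη
    obtain ⟨ρ, hρ1, hρ⟩ := henergy η hη
    refine ⟨ρ, hρ1, ?_⟩
    simp only [hℓ₀]
    obtain ⟨Mρ, hMρ⟩ := levelLift_abs_sum_le hδ ρ
    have hsbd : ∀ n, -(Mρ / 2 + 1) ≤ ℓ n ρ halff ∧ ℓ n ρ halff ≤ Mρ / 2 + 1 := fun n => by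
      refine levelLift_mean_mem_Icc (Ω := fun S => IsRootedPattern δ ρ S)
        (h1 n ρ) (h2 n ρ) (h3 n ρ) (h4 n ρ) (by linarith [(abs_nonneg _).trans (hMρ ∅ (Literature.Probability.PointProcesses.isRootedPattern_empty δ ρ))]) (fun S hS => ?_)
      have h := hMρ S hS
      rw [abs_le] at h
      simp only [hhalff]
      constructor <;> linarith [h.1, h.2]
    have hmono : Λ (fun n => ℓ n ρ halff) ≤ Λ (fun n => estar + η / 2 + (1 + θ / 2) * κ n) := by
      refine levelLift_mean_mono (Ω := fun _ => True) hΛadd hΛsmul hΛpos'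
        (M := |estar| + η / 2 + (1 + θ / 2) + (Mρ / 2 + 1) + 1)
        (by linarith [abs_nonneg estar, (abs_nonneg _).trans (hMρ ∅ (Literature.Probability.PointProcesses.isRootedPattern_empty δ ρ))])
        (fun n _ => by linarith [hρ n]) (fun n _ => ?_)
      have hk := hκ1 n
      have hk0 := (hκ0 n).le
      have : (1 + θ / 2) * κ n ≤ (1 + θ / 2) := by nlinarith
      linarith [le_abs_self estar, (hsbd n).1]
    have hlin : Λ (fun n => estar + η / 2 + (1 + θ / 2) * κ n) = estar + η / 2 := by
      have h : (fun n => estar + η / 2 + (1 + θ / 2) * κ n) =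
          (fun _ => estar + η / 2) + (1 + θ / 2) • κ := by
        funext n; simp only [Pi.add_apply, Pi.smul_apply, smul_eq_mul]
      rw [h, hΛadd, hΛsmul, levelLift_mean_const hΛsmul hΛone,
        bridge_banachLimit_inv_add_two hΛadd hΛsmul hΛpos hΛone hΛzero, mul_zero, add_zero]
    linarith
  -- the qualitative core kills the defect mass of `ℓ₀`, but it is `≥ θ/2`
  have hzero := hP δ hδ ℓ₀ G1 G2 G3 G4 G5 G6 hmin R ε hR hε
  have hpos : θ / 2 ≤ ℓ₀ (R + ε) badf := by
    simp only [hℓ₀]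
    have h := levelLift_mean_mono (Ω := fun _ => True) hΛadd hΛsmul hΛpos'
      (f := fun _ => θ / 2) (g := fun n => ℓ n (R + ε) badf) (M := 1) one_pos
      (fun n _ => (hbθ n).le) (fun n _ => by linarith [(hb01 n).2, hθ])
    rwa [levelLift_mean_const hΛsmul hΛone] at h
  simp only [hℓ₀, hbadf] at hzero hpos
  linarith



end Summit.AtomisticToContinuum.Crystallization.Theorems.PatternPricedCertificates

end
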